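import Summits.HodgeConjecture.HodgeConjecture.Theses.SevenfoldWeilCensus
import Summits.HodgeConjecture.HodgeConjecture.Theorems.HeckePrymWeilWeilSixfoldsSqrtMinus7StubHyperbolicFlat
import HarnessLib

/-!
# Hyperbolic Weil type is constant along a Weil family of sixfolds, for every `d` (`isHyperbolicWeilType_transport`)

Routes `SevenfoldWeilCensus` / `NodalThetaWeil` / `TropicalCuspLift` (sub-problem `HodgeConjecture`), crux `WeilSixfolds`
(stmt-HodgeConjecture-2524), strategist line `perry-cm-tower-all-d` (`Cruxes/WeilSixfolds/Lines/perry_cm_tower_all_d.lean`):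
the `d`-FREE content of the sibling crux's landed `stub_hyperbolicFlat` (stmt-1260, p156265, whose proof never used `φ² = -7`,
`A.dim = 6` or the rationality of `Θ_s`), proved verbatim on the tree's `transportFun` API (supporting file; it does not close
the item).

Along a smooth projective family `f : 𝒳 ⟶ S` of relative dimension `6` over a smooth irreducible quasi-projective base, with a
global endomorphism `g` over `S` and a global class `Θ ∈ H²(𝒳(ℂ); ℂ)`, for two fibres with abelian charts `e : A ≅ 𝒳_s`,
`e' : A' ≅ 𝒳_{s'}` intertwining `g` with `φ`, `φ'`: if `(A, φ, e^*Θ_s)` is of hyperbolic Weil type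
(`Motives.IsHyperbolicWeilType A φ 3 _`: a rational, `ℂ`-independent, `φ^*`-stable `6`-frame of `H¹(A(ℂ); ℂ)` pairwise
isotropic for `Q_h(x, y) = h⁵ ⌣ (x ⌣ y)`), then so is `(A', φ', e'^*Θ_{s'})`.  Proof: `S(ℂ)` is a path-connected manifold,
`R• f_* ℂ` is a local system on it (Ehresmann), parallel transport along a path from `s` to `s'` is `ℂ`-linear and injective,
preserves rational classes, commutes with the fibre maps of the global `g` and with the polarization pairings of the
restrictions of the ONE global class `Θ`; the charts move frames between `A`, `A'` and the fibres.  Used by the line's reduction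
theorem (`SevenfoldWeilCensusWeilSixfoldsOfPerryCmTower.lean`) to send the `A`'s whose family has a HYPERBOLIC CM anchor to
Markman's theorem.  No `sorry`, no definition, no named fact.
-/

noncomputable section

set_option linter.dupNamespace false

open CategoryTheory AlgebraicGeometry Limits
open Literature.AlgebraicGeometry Literature.AlgebraicGeometry.Motives
  Literature.AlgebraicGeometry.HodgeTheory
open Literature.AlgebraicTopology.SingularHomology

namespace Summit.HodgeConjecture.HodgeConjecture.Theorems.SevenfoldWeilCensusLine.PerryCmTowerAllD

/-! ### Hyperbolicity is constant along the family (every `d`) -/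

/-- Round trip along an isomorphism of `ℂ`-schemes: `e.hom^* (e.inv^* x) = x`.
[cite: FultonYoungTableaux1997, Appendix B §B.1 (1)] -/
private theorem map_hom_map_inv_apply {X Y : SchemeOver ℂ} (e : X ≅ Y) (k : ℕ)
    (x : complexBetti X k) : complexBetti.map e.hom k (complexBetti.map e.inv k x) = x := by
  rw [← CategoryTheory.comp_apply, ← complexBetti.map_comp, Iso.hom_inv_id, complexBetti.map_id,
    CategoryTheory.id_apply]

/-- Round trip along an isomorphism of `ℂ`-schemes: `e.inv^* (e.hom^* y) = y`.
[cite: FultonYoungTableaux1997, Appendix B §B.1 (1)] -/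
private theorem map_inv_map_hom_apply {X Y : SchemeOver ℂ} (e : X ≅ Y) (k : ℕ)
    (y : complexBetti Y k) : complexBetti.map e.inv k (complexBetti.map e.hom k y) = y := by
  rw [← CategoryTheory.comp_apply, ← complexBetti.map_comp, Iso.inv_hom_id, complexBetti.map_id,
    CategoryTheory.id_apply]

/-- Contravariant functoriality on elements: `a^* (b^* z) = (a ≫ b)^* z`.
[cite: FultonYoungTableaux1997, Appendix B §B.1 (1)] -/
private theorem map_map_apply {X Y Z : SchemeOver ℂ} (a : X ⟶ Y) (b : Y ⟶ Z) (k : ℕ)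
    (z : complexBetti Z k) :
    complexBetti.map a k (complexBetti.map b k z) = complexBetti.map (a ≫ b) k z := by
  rw [complexBetti.map_comp, CategoryTheory.comp_apply]

/-- **HYPERBOLICITY IS CONSTANT ALONG A WEIL FAMILY OF SIXFOLDS (every `d`; PROVED).**  Along a smooth projective
family `f : 𝒳 ⟶ S` of relative dimension `6` over a smooth irreducible quasi-projective base with a global
endomorphism `g` over `S` and a global class `Θ ∈ H²(𝒳)`, for two fibres with abelian charts `e : A ≅ 𝒳_s`,
`e' : A' ≅ 𝒳_{s'}` intertwining `g` with `φ`, `φ'`: if `(A, φ, e^*Θ_s)` is of hyperbolic Weil type, so is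
`(A', φ', e'^*Θ_{s'})`.  This is the `d`-free content of the sibling's landed `stub_hyperbolicFlat` (p156265,
whose proof never used `φ² = -7`): parallel transport in the local system `R¹f_*ℂ` along a path is injective
linear, preserves rationality, intertwines the fibre maps of `g`, and respects the polarization pairings of the
restrictions of the ONE global class `Θ`.
[cite: VoisinHodgeII2003, §3.1.2 (local systems and flat transport)]
[cite: vanGeemen1994HodgeAV, 5.2–5.4 (hyperbolic = det H ≡ (-1)ⁿ)] -/
theorem isHyperbolicWeilType_transport :
    ∀ (𝒳 S : SchemeOver ℂ) (f : 𝒳 ⟶ S) (g : 𝒳 ⟶ 𝒳), IsSmoothProjectiveFamily f (2 * 3) → IrreducibleSpace S.left → AlgebraicGeometry.Smooth S.hom → IsQuasiProjectiveOver S → g ≫ f = f → ∀ (Θ : complexBetti 𝒳 2) (s s' : ComplexPoints S) (A : AbelianVariety ℂ) (φ : A ⟶ A) (e : A.X ≅ fiberOver f s) (A' : AbelianVariety ℂ) (φ' : A' ⟶ A') (e' : A'.X ≅ fiberOver f s'), (e.hom ≫ fiberι f s) ≫ g = φ.hom.hom.hom ≫ (e.hom ≫ fiberι f s) → (e'.hom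 ≫ fiberι f s') ≫ g = φ'.hom.hom.hom ≫ (e'.hom ≫ fiberι f s') → Literature.AlgebraicGeometry.Motives.IsHyperbolicWeilType A φ 3 (complexBetti.map e.hom 2 (complexBetti.map (fiberι f s) 2 Θ)) → Literature.AlgebraicGeometry.Motives.IsHyperbolicWeilType A' φ' 3 (complexBetti.map e'.hom 2 (complexBetti.map (fiberι f s') 2 Θ)) := by
  intro 𝒳 S f g hfam hirr hsm hSqp hg Θ s s' A φ e A' φ' e' he he' hhyp
  -- the base: `S(ℂ)` is a path-connected manifold and `R• f_* ℂ` is a local system on it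
  haveI := hsm
  haveI := hirr
  haveI : LocallyOfFiniteType S.hom := hSqp.locallyOfFiniteType
  haveI : ConnectedSpace (ComplexPoints S) :=
    (Motives.ComplexPoints.connectedSpace_iff_holds S).2 inferInstance
  obtain ⟨d, hd⟩ := exists_smoothOfRelativeDimension_of_connectedSpace_complexPoints S
  haveI := hd
  haveI := pathConnectedSpace_complexPoints_of_smoothOfRelativeDimension S d
  have hU := isCohomologicallyLocallyTrivialOn_univ_of_isSmoothProjectiveFamily f d hfam hSqp
  -- the fibre maps of `g`
  choose gf hgf using fun t ↦ exists_fiberHom_comp_fiberι f g hg t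
  -- view `s`, `s'` as points of the (trivialising) subset `univ ⊆ S(ℂ)` and join them by a path
  obtain ⟨xs, rfl⟩ : ∃ xs : (Set.univ : Set (ComplexPoints S)), (xs : ComplexPoints S) = s :=
    ⟨⟨s, Set.mem_univ s⟩, rfl⟩
  obtain ⟨xs', rfl⟩ : ∃ xs' : (Set.univ : Set (ComplexPoints S)), (xs' : ComplexPoints S) = s' :=
    ⟨⟨s', Set.mem_univ s'⟩, rfl⟩
  haveI : PathConnectedSpace (Set.univ : Set (ComplexPoints S)) :=
    isPathConnected_iff_pathConnectedSpace.1 (pathConnectedSpace_iff_univ.1 inferInstance)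
  let γ : Path xs xs' := PathConnectedSpace.somePath xs xs'
  -- the transport `L := e'^* ∘ γ_* ∘ e^{-1 *} : H¹(A) → H¹(A')`, an injective linear map
  obtain ⟨L, hL⟩ : ∃ L : complexBetti A.X 1 →ₗ[ℂ] complexBetti A'.X 1, ∀ x, L x =
      complexBetti.map e'.hom 1 (transportFun f 1 hU ⟦γ⟧ (complexBetti.map e.inv 1 x)) :=
    ⟨(complexBetti.map e'.hom 1).hom ∘ₗ transportLinear f 1 hU ⟦γ⟧ ∘ₗ (complexBetti.map e.inv 1).hom,
      fun x ↦ rfl⟩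
  have heg : e.hom ≫ gf xs = φ.hom.hom.hom ≫ e.hom :=
    hom_comp_fiberHom_eq_of_comp_fiberι f g (hgf xs) e φ.hom.hom.hom he
  have heg' : e'.hom ≫ gf xs' = φ'.hom.hom.hom ≫ e'.hom :=
    hom_comp_fiberHom_eq_of_comp_fiberι f g (hgf xs') e' φ'.hom.hom.hom he'
  have hinjB : Function.Injective (complexBetti.map e.inv 1) :=
    Function.LeftInverse.injective (g := complexBetti.map e.hom 1) fun x ↦ map_hom_map_inv_apply e 1 x
  have hinjA : Function.Injective (complexBetti.map e'.hom 1) :=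
    Function.LeftInverse.injective (g := complexBetti.map e'.inv 1) fun y ↦ map_inv_map_hom_apply e' 1 y
  have hinjT := transportFun_injective f 1 hU ⟦γ⟧
  have hLinj : Function.Injective L := by
    intro x y hxy
    rw [hL, hL] at hxy
    exact hinjB (hinjT (hinjA hxy))
  -- the hyperbolic frame on `A` and its transport `L ∘ u` to `A'`
  obtain ⟨u, hrat, hind, hstab, hiso⟩ := hhyp
  refine ⟨fun i ↦ L (u i), fun i ↦ ?_, hind.map_injOn L hLinj.injOn, fun i ↦ ?_, fun i j ↦ ?_⟩
  · -- rationality: `e^{-1 *}`, `γ_*`, `e'^*` preserve rational classes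
    beta_reduce
    rw [hL]
    exact (isRationalClass_transportFun_of_isSmoothProjectiveFamily f 1 d hfam hSqp ⟦γ⟧
      ((hrat i).map (Motives.AlgPoints.mapContinuous (L := ℂ) e.inv))).map
        (Motives.AlgPoints.mapContinuous (L := ℂ) e'.hom)
  · -- `φ'^*`-stability: `φ'^* (L uᵢ) = L (φ^* uᵢ)` and `L` is linear
    beta_reduce
    have hcomp : gf xs ≫ e.inv = e.inv ≫ φ.hom.hom.hom := by
      rw [Iso.comp_inv_eq, Category.assoc, ← heg, Iso.inv_hom_id_assoc]
    have h1 : complexBetti.map (gf xs) 1 (complexBetti.map e.inv 1 (u i)) =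
        complexBetti.map e.inv 1 (complexBetti.map φ.hom.hom.hom 1 (u i)) := by
      rw [map_map_apply, map_map_apply, hcomp]
    have h2 : transportFun f 1 hU ⟦γ⟧ (complexBetti.map (gf xs) 1 (complexBetti.map e.inv 1 (u i))) =
        complexBetti.map (gf xs') 1 (transportFun f 1 hU ⟦γ⟧ (complexBetti.map e.inv 1 (u i))) :=
      transportFun_map_fiberHom f 1 hU g hg gf hgf ⟦γ⟧ _
    have h3 : ∀ y, complexBetti.map φ'.hom.hom.hom 1 (complexBetti.map e'.hom 1 y) =
        complexBetti.map e'.hom 1 (complexBetti.map (gf xs') 1 y) := fun y ↦ by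
      rw [map_map_apply, map_map_apply, heg']
    have key : complexBetti.map φ'.hom.hom.hom 1 (L (u i)) =
        L (complexBetti.map φ.hom.hom.hom 1 (u i)) := by
      rw [hL, hL, h3, ← h2, h1]
    have hrange : Set.range (fun i ↦ L (u i)) = L '' Set.range u := Set.range_comp L u
    rw [key, hrange, Submodule.span_image]
    exact Submodule.mem_map_of_mem (hstab i)
  · -- isotropy: `Q_{e'^*Θ_{s'}}(L uᵢ, L uⱼ) = e'^* γ_* e^{-1 *} Q_{e^*Θ_s}(uᵢ, uⱼ) = 0`
    beta_reduce
    rw [hL, hL, ← map_polarizationPairingOne]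
    have h4 : polarizationPairingOne (fiberOver f xs') (complexBetti.map (fiberι f xs') 2 Θ) (2 * 3 - 1)
          (transportFun f 1 hU ⟦γ⟧ (complexBetti.map e.inv 1 (u i)))
          (transportFun f 1 hU ⟦γ⟧ (complexBetti.map e.inv 1 (u j))) =
        transportFun f (2 + 2 * (2 * 3 - 1)) hU ⟦γ⟧
          (polarizationPairingOne (fiberOver f xs) (complexBetti.map (fiberι f xs) 2 Θ) (2 * 3 - 1)
            (complexBetti.map e.inv 1 (u i)) (complexBetti.map e.inv 1 (u j))) :=
      (transportFun_polarizationPairingOne f hU Θ ⟦γ⟧ (2 * 3 - 1) _ _).symm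
    have h5 : polarizationPairingOne (fiberOver f xs) (complexBetti.map (fiberι f xs) 2 Θ) (2 * 3 - 1)
          (complexBetti.map e.inv 1 (u i)) (complexBetti.map e.inv 1 (u j)) = 0 := by
      have h6 : complexBetti.map (fiberι f xs) 2 Θ =
          complexBetti.map e.inv 2 (complexBetti.map e.hom 2 (complexBetti.map (fiberι f xs) 2 Θ)) :=
        (map_inv_map_hom_apply e 2 _).symm
      rw [h6, ← map_polarizationPairingOne, hiso i j, map_zero]
    rw [h4, h5, transportFun_zero, map_zero]

end Summit.HodgeConjecture.HodgeConjecture.Theorems.SevenfoldWeilCensusLine.PerryCmTowerAllD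

end
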